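import Mathlib
import Summits.HubbardSuperconductivity.HubbardSuperconductivity.Theorems.BalabanIRBirGappedPhaseReductionRBlockLondon
import Summits.HubbardSuperconductivity.HubbardSuperconductivity.Theorems.BalabanIRBirGappedPhaseReductionRBlockLondonStripStiffness
import Summits.HubbardSuperconductivity.HubbardSuperconductivity.Theorems.BalabanIRBirGappedPhaseReductionRBlockLondonUniformGap

/-!
# Route BalabanIR — crux 4R `BirGappedPhaseReductionR` (item `stmt-HubbardSuperconductivity-14846`):
# block-London coercivity XI — GAP-UNIFORM block-London phase rigidity of the `d+id` BdG reference
# on a cone of pairing ratios (card `london-block-coercivity`, first lemma, PROVED on cones)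

THEOREM (`bdgBlockLondonCoercivity_cone`).  For every band-interior `μ ∈ (-4,4)` and every cone
parameter `0 < ε ≤ 1` there are a constant `c = c(μ,ε) > 0` and a smallness `Δ₀ = Δ₀(μ,ε) > 0`
such that for ALL gaps `Δ₁, Δ₂ ≠ 0` on the cone `ε|Δ₂| ≤ |Δ₁| ≤ |Δ₂|/ε` with
`|Δ₁| + |Δ₂| ≤ Δ₀` there are a block side `ℓ` and a threshold `L₀` with: for every `L ≥ L₀`,
`ℓ ∣ L`, and EVERY phase texture `θ` of the crux-3 Bogoliubov–de Gennes matrix `Hb(θ)`,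
  `c · Σ_{blocks b} (|m_b - m_{b+ℓe₀}|² + |m_b - m_{b+ℓe₁}|²) ≤ Σ|λ(Hb 0)| - Σ|λ(Hb θ)|`
(`m_b(θ) = ℓ⁻² Σ_{x ∈ b} e^{iθ_x}` the block circular means) — the constant does NOT degrade with
the gap, in contrast with the lattice constant of crux 3 (`∝ Δ³` as proved, `≤ Δ² log` at best).
PROOF = `blockLondon_of_kernelSymbolIneq` (III) with the kernel symbol inequality established
by the stiffness bound `kernelSymbol_stiffness` (IX; small momenta, through the squared minimal
representative `blockSymbol_le_sq`) and the positivity `kernelSymbol_pos_far` (IV; large momenta,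
through `blockSymbol_le_eight` and a large even block side), the two regimes being separated at
`‖v‖_∞ = q₀|Δ₂|` and glued by the linear gap bound `uniform_gap_linear` (X;
`m = κ·min(|Δ₁|,|Δ₂|) ≥ κε|Δ₂|`).  This is the card's `BdGBlockLondonCoercivity` restricted to ratio
cones (the restriction is forced by the multiplier `m = min E` of `lyap_core`, cf. triage F1); the
bridge to the card's definitions is `simp only [bdgRef, bdgHop, bdgPair, blockMisalignment,
blockMean, blockCorner, nnx, nny, dg1, dg2]`.  No definition is introduced.
-/

noncomputable section

namespace Summit.HubbardSuperconductivity.HubbardSuperconductivity.Theorems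

namespace BirBdG

open Finset Literature.Probability.LatticeModels

/-- Lattice momenta lie in `[0, 2π)`. [folklore] -/
theorem latticeMomentum_lt_two_pi {L : ℕ} [NeZero L] (k : TorusSite 2 L) (i : Fin 2) :
    0 ≤ latticeMomentum L k i ∧ latticeMomentum L k i < 2 * Real.pi := by
  have hL : (0 : ℝ) < L := by exact_mod_cast Nat.pos_of_ne_zero (NeZero.ne L)
  have hv : ((k i).val : ℝ) < L := by exact_mod_cast ZMod.val_lt (k i)
  unfold latticeMomentum
  refine ⟨by positivity, ?_⟩
  rw [div_lt_iff₀ hL]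
  nlinarith [Real.pi_pos]

/-- The minimal representative `v` of a lattice momentum: `v ≡ p (mod 2π)`, `|v| = min(p, 2π-p)`,
`|v| ≤ π`. [folklore] -/
theorem minRep_spec {L : ℕ} [NeZero L] (q : TorusSite 2 L) (i : Fin 2) :
    (∃ n : ℤ, (if latticeMomentum L q i ≤ Real.pi then latticeMomentum L q i
        else latticeMomentum L q i - 2 * Real.pi) = latticeMomentum L q i + 2 * Real.pi * n) ∧
      |(if latticeMomentum L q i ≤ Real.pi then latticeMomentum L q i
        else latticeMomentum L q i - 2 * Real.pi)| =
        min (latticeMomentum L q i) (2 * Real.pi - latticeMomentum L q i) := by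
  obtain ⟨h0, h1⟩ := latticeMomentum_lt_two_pi q i
  by_cases h : latticeMomentum L q i ≤ Real.pi
  · rw [if_pos h]
    refine ⟨⟨0, by simp⟩, ?_⟩
    rw [abs_of_nonneg h0, min_eq_left (by linarith)]
  · rw [if_neg h]
    refine ⟨⟨-1, by push_cast; ring⟩, ?_⟩
    push Not at h
    rw [abs_of_neg (by linarith), min_eq_right (by linarith)]
    ring

/-- **Gap-uniform block-London phase rigidity of the `d+id` BdG reference on ratio cones.**
See the module docstring. [folklore] -/
theorem bdgBlockLondonCoercivity_cone : ∀ (μ ε : ℝ), μ ∈ Set.Ioo (-4 : ℝ) 4 → 0 < ε → ε ≤ 1 → ∃ c : ℝ, 0 < c ∧ ∃ Δ₀ : ℝ, 0 < Δ₀ ∧ ∀ (Δ₁ Δ₂ : ℝ), Δ₁ ≠ 0 → Δ₂ ≠ 0 → ε * |Δ₂| ≤ |Δ₁| → |Δ₁| ≤ |Δ₂| / ε → |Δ₁| + |Δ₂| ≤ Δ₀ → ∃ ℓ : ℕ, 0 < ℓ ∧ ∃ L₀ : ℕ, ∀ (L : ℕ) [NeZero L], L₀ ≤ L → ℓ ∣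 L → let nnx : Literature.Probability.LatticeModels.TorusSite 2 L → Literature.Probability.LatticeModels.TorusSite 2 L → Prop := fun x y => y = x + ![1, 0] ∨ y = x + ![-1, 0]; let nny : Literature.Probability.LatticeModels.TorusSite 2 L → Literature.Probability.LatticeModels.TorusSite 2 L → Prop := fun x y => y = x + ![0, 1] ∨ y = x + ![0, -1]; let dg1 : Literature.Probability.LatticeModels.TorusSite 2 L → Literature.Probability.LatticeModels.TorusSite 2 L → Prop := fun x y => y = x + ![1, 1] ∨ y = x + ![-1, -1]; let dg2 : Literature.Probability.LatticeModels.TorusSite 2 L → Literature.Probability.LatticeModels.TorusSite 2 L → Prop := fun x y => y = x + ![1, -1] ∨ y = x + ![-1, 1]; let h : Matrix (Literature.Probability.LatticeModels.TorusSite 2 L) (Literature.Probability.LatticeModels.TorusSite 2 L) ℂ := fun x y => -(if nnx x y ∨ nny x y then (1 : ℂ) else 0) - (if x = y then (μ : ℂ) else 0); let D : (Literature.Probability.LatticeModels.TorusSite 2 L → ℝ) → Matrix (Literature.Probability.LatticeModels.TorusSite 2 L) (Literature.Probability.LatticeModels.TorusSite 2 L) ℂ := fun θ x y => ((Δ₁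 : ℂ) * ((if nnx x y then (1 : ℂ) else 0) - (if nny x y then (1 : ℂ) else 0)) + Complex.I * (Δ₂ : ℂ) * ((if dg1 x y then (1 : ℂ) else 0) - (if dg2 x y then (1 : ℂ) else 0))) * (Complex.exp (Complex.I * (θ x : ℂ)) + Complex.exp (Complex.I * (θ y : ℂ))) / 2; let Hb : (Literature.Probability.LatticeModels.TorusSite 2 L → ℝ) → Matrix (Literature.Probability.LatticeModels.TorusSite 2 L ⊕ Literature.Probability.LatticeModels.TorusSite 2 L) (Literature.Probability.LatticeModels.TorusSite 2 L ⊕ Literature.Probability.LatticeModels.TorusSite 2 L) ℂ := fun θ => Matrix.fromBlocks h (D θ) (Matrix.conjTranspose (D θ)) (-h); let bc : Literature.Probability.LatticeModels.TorusSite 2 L → Literature.Probability.LatticeModels.TorusSite 2 L := fun x => ![(((x 0).val / ℓ * ℓ : ℕ) : ZMod L), (((x 1).val / ℓ * ℓ : ℕ) : ZMod L)]; let bm : (Literature.Probability.LatticeModels.TorusSite 2 L → ℝ) → Literature.Probability.LatticeModels.TorusSite 2 L → ℂ := fun θ b => (∑ x : Literature.Probability.LatticeModels.TorusSite 2 L,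 if bc x = b then Complex.exp (Complex.I * (θ x : ℂ)) else 0) / ((ℓ : ℂ) ^ 2); ∀ θ : Literature.Probability.LatticeModels.TorusSite 2 L → ℝ, ∀ (hθ : (Hb θ).IsHermitian) (h0 : (Hb (fun _ => 0)).IsHermitian), c * ∑ b : Literature.Probability.LatticeModels.TorusSite 2 L, (if bc b = b then (‖bm θ b - bm θ (b + ![((ℓ : ℕ) : ZMod L), 0])‖ ^ 2 + ‖bm θ b - bm θ (b + ![0, ((ℓ : ℕ) : ZMod L)])‖ ^ 2) else 0) ≤ ∑ i, |h0.eigenvalues i| - ∑ i, |hθ.eigenvalues i| := by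
  intro μ ε hμ hε hε1
  obtain ⟨κ, hκ, hgap⟩ := uniform_gap_linear μ hμ
  obtain ⟨q₀, c₁, Δ₀', hq₀, hc₁, hΔ₀', HK1⟩ := kernelSymbol_stiffness μ ε hμ hε
  obtain ⟨cf, hcf⟩ : ∃ cf : ℝ, cf = κ * ε * c₁ / 8 := ⟨_, rfl⟩
  have hcfpos : 0 < cf := by rw [hcf]; positivity
  refine ⟨cf, hcfpos, min Δ₀' 1, lt_min hΔ₀' one_pos, ?_⟩
  intro Δ₁ Δ₂ h₁ h₂ hcone1 hcone2 hsmall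
  have hsmall' : |Δ₁| + |Δ₂| ≤ Δ₀' := hsmall.trans (min_le_left _ _)
  have hsmall1 : |Δ₁| + |Δ₂| ≤ 1 := hsmall.trans (min_le_right _ _)
  have hΔ₂pos : 0 < |Δ₂| := abs_pos.2 h₂
  have hΔ₁pos : 0 < |Δ₁| := abs_pos.2 h₁
  -- the uniform gap `m = κ · min(|Δ₁|,|Δ₂|) ≥ κ ε |Δ₂|`
  obtain ⟨m, hm_def⟩ : ∃ m : ℝ, m = κ * min |Δ₁| |Δ₂| := ⟨_, rfl⟩
  have hmin1 : min |Δ₁| |Δ₂| ≤ 1 := by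
    have := min_le_left |Δ₁| |Δ₂|; linarith [abs_nonneg Δ₂]
  have hminpos : 0 < min |Δ₁| |Δ₂| := lt_min hΔ₁pos hΔ₂pos
  have hm : 0 < m := by rw [hm_def]; exact mul_pos hκ hminpos
  have hmlow : κ * ε * |Δ₂| ≤ m := by
    rw [hm_def, mul_assoc]
    apply mul_le_mul_of_nonneg_left _ hκ.le
    exact le_min hcone1 (by nlinarith)
  -- (K1) and (K2) at these gaps
  obtain ⟨L₁, HK1'⟩ := HK1 Δ₁ Δ₂ h₁ h₂ hcone2 hsmall'
  have hr₀ : 0 < q₀ * |Δ₂| := mul_pos hq₀ hΔ₂pos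
  obtain ⟨s₀, hs₀, L₂, HK2⟩ := kernelSymbol_pos_far μ Δ₁ Δ₂ (q₀ * |Δ₂|) hμ h₁ h₂ hr₀
  -- the block side: even, and `ℓ² ≥ 32 cf/(m s₀)`
  obtain ⟨ℓ, hℓ_def⟩ : ∃ ℓ : ℕ, ℓ = 2 * (⌈Real.sqrt (32 * cf / (m * s₀))⌉₊ + 1) := ⟨_, rfl⟩
  have hℓpos : 0 < ℓ := by rw [hℓ_def]; positivity
  have hℓeven : Even ℓ := by rw [hℓ_def]; exact even_two_mul _
  have hℓsq : 32 * cf / (m * s₀) ≤ (ℓ : ℝ) ^ 2 := by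
    have hx : 0 ≤ 32 * cf / (m * s₀) := by positivity
    have h1 : Real.sqrt (32 * cf / (m * s₀)) ≤ (ℓ : ℝ) := by
      rw [hℓ_def]; push_cast
      have := Nat.le_ceil (Real.sqrt (32 * cf / (m * s₀)))
      linarith [Real.sqrt_nonneg (32 * cf / (m * s₀))]
    calc 32 * cf / (m * s₀) = Real.sqrt (32 * cf / (m * s₀)) ^ 2 := (Real.sq_sqrt hx).symm
      _ ≤ (ℓ : ℝ) ^ 2 := pow_le_pow_left₀ (Real.sqrt_nonneg _) h1 2
  refine ⟨ℓ, hℓpos, max (max L₁ L₂) 3, fun L _ hL hdiv => ?_⟩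
  have hL1 : L₁ ≤ L := le_trans (le_trans (le_max_left _ _) (le_max_left _ _)) hL
  have hL2 : L₂ ≤ L := le_trans (le_trans (le_max_right _ _) (le_max_left _ _)) hL
  have hL3 : 3 ≤ L := le_trans (le_max_right _ _) hL
  have hLeven : Even L := (even_iff_two_dvd.2 (dvd_trans (even_iff_two_dvd.1 hℓeven) hdiv))
  have hN : (0 : ℝ) < ((L ^ 2 : ℕ) : ℝ) := by positivity
  -- the lattice symbols of side `L`
  set ξ : TorusSite 2 L → ℝ := fun k =>
    -2 * Real.cos (latticeMomentum L k 0) - 2 * Real.cos (latticeMomentum L k 1) - μ with hξ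
  set Δ : TorusSite 2 L → ℂ := fun k =>
    ((2 * Δ₁ * (Real.cos (latticeMomentum L k 0) - Real.cos (latticeMomentum L k 1)) : ℝ) : ℂ) -
      4 * Complex.I * ((Δ₂ * Real.sin (latticeMomentum L k 0) * Real.sin (latticeMomentum L k 1) : ℝ) : ℂ)
    with hΔ
  set E : TorusSite 2 L → ℝ := fun k => Real.sqrt (ξ k ^ 2 + ‖Δ k‖ ^ 2) with hE
  have hmE : ∀ k, m ≤ E k := fun k => by
    rw [hm_def]
    exact hgap Δ₁ Δ₂ _ _ hmin1 (lyap_latticeMomentum_mem k 0) (lyap_latticeMomentum_mem k 1)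
  -- the kernel symbol inequality with constant `4 cf / m`
  have hSYM : ∀ q : TorusSite 2 L, 4 * cf / m * (((ℓ : ℝ) ^ 2)⁻¹ *
      (‖1 - torusChar q ![((ℓ : ℕ) : ZMod L), 0]‖ ^ 2 + ‖1 - torusChar q ![0, ((ℓ : ℕ) : ZMod L)]‖ ^ 2)) ≤
      ((L ^ 2 : ℕ) : ℝ)⁻¹ * ∑ k : TorusSite 2 L, ‖Δ k / (E k : ℂ) - Δ (k + q) / (E (k + q) : ℂ)‖ ^ 2 := by
    intro q
    -- the minimal representative of `2πq/L`
    obtain ⟨v, hv⟩ : ∃ v : Fin 2 → ℝ, v = fun i => if latticeMomentum L q i ≤ Real.pi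
        then latticeMomentum L q i else latticeMomentum L q i - 2 * Real.pi := ⟨_, rfl⟩
    have hvrep : ∀ i, ∃ n : ℤ, v i = latticeMomentum L q i + 2 * Real.pi * n := fun i => by
      rw [hv]; exact (minRep_spec q i).1
    have hvabs : ∀ i, |v i| = min (latticeMomentum L q i) (2 * Real.pi - latticeMomentum L q i) :=
      fun i => by rw [hv]; exact (minRep_spec q i).2
    set SL : ℝ := ((L ^ 2 : ℕ) : ℝ)⁻¹ *
      ∑ k : TorusSite 2 L, ‖Δ k / (E k : ℂ) - Δ (k + q) / (E (k + q) : ℂ)‖ ^ 2 with hSL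
    have hSL0 : 0 ≤ SL := mul_nonneg (inv_nonneg.2 hN.le) (Finset.sum_nonneg fun k _ => sq_nonneg _)
    set B : ℝ := ((ℓ : ℝ) ^ 2)⁻¹ *
      (‖1 - torusChar q ![((ℓ : ℕ) : ZMod L), 0]‖ ^ 2 + ‖1 - torusChar q ![0, ((ℓ : ℕ) : ZMod L)]‖ ^ 2) with hB
    by_cases hsmallv : ∀ i, |v i| ≤ q₀ * |Δ₂|
    · -- small momenta: stiffness
      have hK1 := HK1' L hL1 ξ E Δ (fun _ => rfl) (fun _ => rfl) (fun _ => rfl) q v hvrep hsmallv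
      change c₁ * (max |v 0| |v 1|) ^ 2 ≤ |Δ₂| * SL at hK1
      have hBv : B ≤ v 0 ^ 2 + v 1 ^ 2 := blockSymbol_le_sq q hℓpos v hvrep
      have hvmax : v 0 ^ 2 + v 1 ^ 2 ≤ 2 * (max |v 0| |v 1|) ^ 2 := by
        have h0 : v 0 ^ 2 ≤ (max |v 0| |v 1|) ^ 2 := by
          rw [← sq_abs (v 0)]; exact pow_le_pow_left₀ (abs_nonneg _) (le_max_left _ _) 2
        have h1 : v 1 ^ 2 ≤ (max |v 0| |v 1|) ^ 2 := by
          rw [← sq_abs (v 1)]; exact pow_le_pow_left₀ (abs_nonneg _) (le_max_right _ _) 2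
        linarith
      -- `(4cf/m) B ≤ (8cf/m) max² = (κεc₁/m) max² ≤ (κε|Δ₂|/m) SL ≤ SL`
      have h1 : 4 * cf / m * B ≤ 4 * cf / m * (2 * (max |v 0| |v 1|) ^ 2) :=
        mul_le_mul_of_nonneg_left (hBv.trans hvmax) (by positivity)
      have h2 : 4 * cf / m * (2 * (max |v 0| |v 1|) ^ 2) = (κ * ε / m) * (c₁ * (max |v 0| |v 1|) ^ 2) := by
        rw [hcf]; ring
      have h3 : (κ * ε / m) * (c₁ * (max |v 0| |v 1|) ^ 2) ≤ (κ * ε / m) * (|Δ₂| * SL) :=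
        mul_le_mul_of_nonneg_left hK1 (by positivity)
      have h4 : (κ * ε / m) * (|Δ₂| * SL) ≤ 1 * SL := by
        rw [← mul_assoc]
        apply mul_le_mul_of_nonneg_right _ hSL0
        rw [div_mul_eq_mul_div, div_le_one hm]
        exact hmlow
      calc 4 * cf / m * B ≤ 4 * cf / m * (2 * (max |v 0| |v 1|) ^ 2) := h1
        _ = (κ * ε / m) * (c₁ * (max |v 0| |v 1|) ^ 2) := h2
        _ ≤ (κ * ε / m) * (|Δ₂| * SL) := h3
        _ ≤ 1 * SL := h4
        _ = SL := one_mul _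
    · -- large momenta: positivity
      push Not at hsmallv
      obtain ⟨i, hi⟩ := hsmallv
      have hfar : ∀ n : Fin 2 → ℤ, q₀ * |Δ₂| ≤
          dist (latticeMomentum L q) (fun j => 2 * Real.pi * (n j : ℝ)) := by
        intro n
        refine le_trans hi.le ?_
        rw [hvabs i]
        obtain ⟨h0, h2π⟩ := latticeMomentum_lt_two_pi q i
        calc min (latticeMomentum L q i) (2 * Real.pi - latticeMomentum L q i)
            ≤ |latticeMomentum L q i - 2 * Real.pi * n i| := abs_sub_int_mul_ge_minRep h0 h2π (n i)
          _ = dist (latticeMomentum L q i) (2 * Real.pi * (n i : ℝ)) := (Real.dist_eq _ _).symm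
          _ ≤ dist (latticeMomentum L q) (fun j => 2 * Real.pi * (n j : ℝ)) :=
              dist_le_pi_dist (latticeMomentum L q) (fun j => 2 * Real.pi * (n j : ℝ)) i
      have hK2 := HK2 L hL2 hLeven ξ E Δ (fun _ => rfl) (fun _ => rfl) (fun _ => rfl) q hfar
      change s₀ ≤ SL at hK2
      have hB8 : B ≤ 8 / (ℓ : ℝ) ^ 2 := blockSymbol_le_eight q hℓpos
      have hℓ2 : (0 : ℝ) < (ℓ : ℝ) ^ 2 := by positivity
      -- `(4cf/m) B ≤ 32 cf/(m ℓ²) ≤ s₀`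
      have h1 : 4 * cf / m * B ≤ 4 * cf / m * (8 / (ℓ : ℝ) ^ 2) :=
        mul_le_mul_of_nonneg_left hB8 (by positivity)
      have h2 : 4 * cf / m * (8 / (ℓ : ℝ) ^ 2) ≤ s₀ := by
        rw [show 4 * cf / m * (8 / (ℓ : ℝ) ^ 2) = (32 * cf / (m * s₀)) * (s₀ / (ℓ : ℝ) ^ 2) by
          field_simp; ring]
        calc (32 * cf / (m * s₀)) * (s₀ / (ℓ : ℝ) ^ 2) ≤ (ℓ : ℝ) ^ 2 * (s₀ / (ℓ : ℝ) ^ 2) :=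
              mul_le_mul_of_nonneg_right hℓsq (by positivity)
          _ = s₀ := by field_simp
      exact h1.trans (h2.trans hK2)
  -- the block-London reduction
  have main := blockLondon_of_kernelSymbolIneq L μ Δ₁ Δ₂ m (4 * cf / m) ℓ hL3 hℓpos hdiv ξ E Δ
    (fun _ => rfl) (fun _ => rfl) (fun _ => rfl) hm hmE hSYM
  intro nnx nny dg1 dg2 h D Hb bc bm θ hθ h0
  have key := main θ hθ h0
  have hconst : m * (4 * cf / m) / 4 = cf := by field_simp
  rw [hconst] at key
  exact key

end BirBdG

end Summit.HubbardSuperconductivity.HubbardSuperconductivity.Theorems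

end
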